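import Summits.QuantumFields.YangMills.Theorems.BalabanUVNodesN15KingModelCurvedKnitInstances
import Summits.QuantumFields.YangMills.Theorems.BalabanUVNodesN15CurvedDressedPairDefectKingTorusUN
import HarnessLib

/-!
# Route «BalabanUVNodes» (cluster K4 «SpineRates»), Track-A DAG node N15 = NE2 — THE KING INHABITANT OF dag-n15-w3's CURVED KNIT AT A CONSTANT **𝔲(N)-VALUED** GAUGE
# FIELD IN THE ADJOINT REPRESENTATION: dag-n15-e's PART Ω-c η-rate `hasMaj_idef_curvDressed_kingTorus_king_rate` at the NON-ABELIAN generator datum `𝔄 = M_N(ℂ)`,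
# `Zc μ = ad_{A_μ}`, `A_μᴴ = −A_μ` (transporter `e^{η′ ad A_μ} = Ad(e^{η′A_μ})`), and a CLOSED edition with the Neumann smallness ABSORBED into the small-field bound
# `‖A_μ‖ ≤ a₀`

Cell `pub-ymgap`, WIDTH SEAT `pub-ymgap-dag-n15-w2` (director-ym №197 ∕ HUMAN RULING D-0149), generation 3, file 1.  `bears_on: R4∕N15 · K3⁷ SpineGivenEndpointR13SepCoPH
(stmt-QuantumFields-20544)`.  Filed `--kind proof --supports stmt-QuantumFields-20544 --as helper` — COUNT-NEUTRAL; theorems only (0 `def`, 0 `sorry`, 0 `instance`; Mathlib's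
SCOPED Frobenius structure on `M_N(ℂ)` as in this seat's g2 files 3–6); imports BY NAME dag-n15-e g14's PART Ω-d `…N15KingModelCurvedKnitInstances` (p599677; through it
PART Ω-c `hasMaj_idef_curvDressed_kingTorus_king_rate`, p598752 lineage) and this seat's g2 file 6 `…N15CurvedDressedPairDefectKingTorusUN` (p599926:
`basisConst_le_sqrt_card_of_traceForm`; through it file 3 p595427: `coordMat_adCLM_transpose_eq_neg_of_conjTranspose`, `traceForm_exists_coords`); b2b `adCLM`,
`norm_adCLM_le`; nothing re-declared.

WHY.  dag-n15-e's PART Ω (files Ω-a … Ω-d) inhabits dag-n15-w3's END-TO-END curved knit `hasMaj_idef_curvDressed_kingTorus` (p595387) with King's full `A = 0` propagator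
on two grids, leaving displayed exactly a generator datum `(𝔄, ι, e, Zc)` — a complete normed ℝ-algebra with coordinates, a CONSTANT generator with `‖Zc μ‖ ≤ r ≤ 1` and
SKEW coordinate matrices — and a Neumann smallness in `r`; PART Ω-d (p599677) supplied the TRIVIAL datum (`Zc = 0`, closed statement) and King's own ABELIAN one
(`𝔄 = ℂ`, `Zc μ = θ_μ·(i·)`).  The programme's fibre is NON-ABELIAN: in [Balaban1985BackgroundPropagators] (3.37) p. 396 ∕ (3.50) p. 400 the transporter acts on
`𝔤`-valued fields by the ADJOINT action `R(U) = Ad(e^{ηA})`, generator `ad_A`.  This seat's g2 files made exactly that case available: for `A ∈ 𝔲(N)` the coordinate matrix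
of `ad_A` in trace-form-orthonormal coordinates is SKEW (file 3), `‖ad_A‖ ≤ 2‖A‖` (b2b), and the basis constant of such coordinates is `≤ √|κ|` (file 6).  THIS FILE is
the one application that puts the non-abelian datum into PART Ω-c, and then removes the last displayed condition: the row letter `R_V(r)` at the flat point is LINEAR-BOUNDED
in `r` (§1), so the Neumann smallness `β·R_V·c_r ≤ ½` HOLDS for every constant `𝔲(N)` field with `‖A_μ‖ ≤ a₀`, `a₀ > 0` depending only on the rung's `(β, δ)`, on `d` and on
the fibre dimension — a CLOSED η-rate statement for a genuinely non-abelian (if constant and flat) transporter.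

WHAT: §1 `expRowLetter_flat_eq` ∕ `expRowLetter_flat_le` (the generator-level row letter at the flat point `r_B = g = 0` is `κer(|ι| + |ι|³) + |ι|²|J|(κer)²
≤ r·(κe(|ι| + |ι|³) + |ι|²|J|κ²e²)` for `0 ≤ r ≤ 1`); §2 ★ `uN_hasMaj_idef_curvDressed_kingTorus_king_rate` — PART Ω-c's `…_king_rate` VERBATIM at `𝔄 = M_N(ℂ)`, `ι = κ`,
`eB = e` trace-form-orthonormal, `Zc μ = ad_{A_μ}`, `r = 2a₀`: displayed only `‖A_μ‖ ≤ a₀`, `2a₀ ≤ 1`, skew-Hermitian values, `he`, and the halved smallness at `r = 2a₀`;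
§3 ★★ `uN_hasMaj_idef_curvDressed_kingTorus_king_closed` — `∃ δ C a₀ > 0, ∀ K ≥ 1, cube 2L^e, 0 < m² ≤ m₀², Msz, ∀ A` skew-Hermitian with `‖A_μ‖ ≤ a₀`: block majorant
`C·((L^K)^{−γ∕2} + (L^K)^{−α})·e^{−(δ∕2)|y−y′|_T}` (smallness absorbed via §1 + `κ_e ≤ √|κ|`; the fit term `r²·L^{−K} ≤ (L^K)^{−α}`); `suN_hasMaj_idef_curvDressed_kingTorus_king_closed`
(`A_μ ∈ suAlgebra N`); ★ `uN_exists_coords_hasMaj_idef_curvDressed_kingTorus_king_closed` — `he` INHABITED in the same file (`traceForm_exists_coords`): for every `N` a fully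
closed non-abelian η-rate statement (A6-clean: nothing displayed but the small-field bound and skew-Hermitian values).

HONEST FRAMING ∕ LIMITS.  One application of dag-n15-e's PART Ω-c + letter arithmetic; King's `A = 0` propagator at the FLAT base point (`W′ ≡ 0`) dressed by a CONSTANT
adjoint transporter — a positive control ∕ non-vacuity certificate of the curved knit's hypothesis list for the programme's fibre `𝔲(N)` ∕ `𝔰𝔲(N)`; NOT an estimate of
Bałaban's `G(U)`, NOT a curved base point, NOT a non-constant field, NOT the non-linear (C3) transport; LINEARISED transport (coarse generator = block mean = the same
constant) as in the whole lineage; nothing of [B6]∕[B9] asserted ((3.37) p. 396, (3.50) p. 400, Thm 3.1 (3.42) p. 397, (3.63)–(3.65) pp. 402–403 cited as SHAPES ∕ MECHANISM;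
[King1986] (2.13)–(2.17) p. 653, Prop. 3.9 (3.73) p. 665 as the template's locators).  NE2⁺ NOT PRINTED ∕ NOT proved for d = 4; N15 NOT discharged; K3⁷ OPEN, not claimed;
counts UNMOVED (typed 28∕28 · discharged 5∕27, A 5∕28); one finite 𝕋⁴ at fixed ε — NOT infinite volume, NOT OS on ℝ⁴, NOT a mass gap, NOT Clay; R4 closes the conditional
finite-𝕋⁴ rung `BalabanLadder.UV` only.  Restate-immune (no Theses import).
-/

set_option autoImplicit false

noncomputable section
open scoped BigOperators Matrix Matrix.Norms.Frobenius
open Finset NormedSpace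

namespace Summit.QuantumFields.YangMills.BalabanUVNodes.N15.CurvedSpecies

open Literature.MathematicalPhysics.QuantumFieldTheory.Balaban1983to89
open Literature.MathematicalPhysics.QuantumFieldTheory.Balaban1983to89.B11SectG (BlockNorm HasMaj)
open Literature.MathematicalPhysics.QuantumFieldTheory.Balaban1983to89.T4EtaRateDefect (idef)
open Literature.MathematicalPhysics.QuantumFieldTheory.Balaban1983to89.T4EtaRateCoeffDefect (pull)
open Literature.MathematicalPhysics.QuantumFieldTheory.Balaban1983to89.B5Prop11Plancherel (Tor fine)
open Literature.MathematicalPhysics.QuantumFieldTheory.King1986.Torus (blockOf tdistT)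
open Literature.MathematicalPhysics.QuantumFieldTheory.Balaban1983to89.Beta.AveragingCorrectionJets (adCLM norm_adCLM_le)
open Literature.Barriers.QuantumFields (traceForm)
open Literature.MathematicalPhysics.QuantumFieldTheory (suAlgebra mem_suAlgebra_iff)
open Summit.QuantumFields.YangMills.BalabanUVNodes.N15.VectorPiece (unitTorusGeoS)
open Summit.QuantumFields.YangMills.BalabanUVNodes.N15.MatrixSpecies (liftMap liftBlk coordMat basisConst basisConst_nonneg)
open Summit.QuantumFields.YangMills.BalabanUVNodes.N15.BackgroundLayer (liftPair blkPair)
open Summit.QuantumFields.YangMills.BalabanUVNodes.N15KingModelRung.Curved (kingGT kingGT₁ hasMaj_idef_curvDressed_kingTorus_king_rate)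

/-! ## §1 The row letter at the flat point is linear-bounded in the generator size -/

section RowLetter

variable (ι J : Type) [Fintype ι] [Fintype J]

/-- THE ROW LETTER AT THE FLAT POINT, IN CLOSED FORM: with `r_B = g = 0`, `expRowLetter κ r 0 0 = κer·(|ι| + |ι|³) + |ι|²|J|·(κer)²` (file 5's `p₀ = κ_e e r`, `q₀ = 0` in
dag-n15-w3's `curvRowLetter`). [folklore] -/
theorem expRowLetter_flat_eq (κ r : ℝ) :
    expRowLetter ι J κ r 0 0 =
      κ * Real.exp 1 * r * ((Fintype.card ι : ℝ) + (Fintype.card ι : ℝ) ^ 3) + (Fintype.card ι : ℝ) ^ 2 * (Fintype.card J : ℝ) * (κ * Real.exp 1 * r) ^ 2 := by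
  unfold expRowLetter curvRowLetter
  ring

/-- THE ROW LETTER AT THE FLAT POINT IS LINEAR-BOUNDED IN `r ∈ [0, 1]`: `expRowLetter κ r 0 0 ≤ r·(κe(|ι| + |ι|³) + |ι|²|J|κ²e²)` (`(κer)² ≤ κ²e²·r` for `r ≤ 1`) — so the
knit's Neumann smallness is a SMALL-FIELD condition. [folklore] -/
theorem expRowLetter_flat_le {κ r : ℝ} (hκ : 0 ≤ κ) (hr0 : 0 ≤ r) (hr1 : r ≤ 1) :
    expRowLetter ι J κ r 0 0 ≤
      r * (κ * Real.exp 1 * ((Fintype.card ι : ℝ) + (Fintype.card ι : ℝ) ^ 3) + (Fintype.card ι : ℝ) ^ 2 * (Fintype.card J : ℝ) * (κ * Real.exp 1) ^ 2) := by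
  rw [expRowLetter_flat_eq]
  have hκe : 0 ≤ κ * Real.exp 1 := mul_nonneg hκ (Real.exp_nonneg 1)
  have hsq : (κ * Real.exp 1 * r) ^ 2 ≤ (κ * Real.exp 1) ^ 2 * r := by
    rw [mul_pow, sq r]
    calc (κ * Real.exp 1) ^ 2 * (r * r) ≤ (κ * Real.exp 1) ^ 2 * (r * 1) := by gcongr
      _ = (κ * Real.exp 1) ^ 2 * r := by rw [mul_one]
  have hcard : 0 ≤ (Fintype.card ι : ℝ) ^ 2 * (Fintype.card J : ℝ) := by positivity
  nlinarith [mul_le_mul_of_nonneg_left hsq hcard]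

/-- The slope of §1's linear bound is nonnegative (for `κ ≥ 0`). [folklore] -/
theorem expRowLetter_flat_slope_nonneg {κ : ℝ} (hκ : 0 ≤ κ) :
    0 ≤ κ * Real.exp 1 * ((Fintype.card ι : ℝ) + (Fintype.card ι : ℝ) ^ 3) + (Fintype.card ι : ℝ) ^ 2 * (Fintype.card J : ℝ) * (κ * Real.exp 1) ^ 2 := by
  have := Real.exp_nonneg 1
  positivity

/-- The slope is MONOTONE in the basis constant `κ ≥ 0` (used with file 6's `κ_e ≤ √|κ|`). [folklore] -/
theorem expRowLetter_flat_slope_mono {κ κ' : ℝ} (hκ : 0 ≤ κ) (hκκ' : κ ≤ κ') :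
    κ * Real.exp 1 * ((Fintype.card ι : ℝ) + (Fintype.card ι : ℝ) ^ 3) + (Fintype.card ι : ℝ) ^ 2 * (Fintype.card J : ℝ) * (κ * Real.exp 1) ^ 2 ≤
      κ' * Real.exp 1 * ((Fintype.card ι : ℝ) + (Fintype.card ι : ℝ) ^ 3) + (Fintype.card ι : ℝ) ^ 2 * (Fintype.card J : ℝ) * (κ' * Real.exp 1) ^ 2 := by
  have he := Real.exp_nonneg 1
  have h1 : κ * Real.exp 1 ≤ κ' * Real.exp 1 := mul_le_mul_of_nonneg_right hκκ' he
  have h0 : 0 ≤ κ * Real.exp 1 := mul_nonneg hκ he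
  gcongr

end RowLetter

/-! ## §2 The non-abelian datum: `𝔄 = M_N(ℂ)`, `Zc μ = ad_{A_μ}`, `A_μ ∈ 𝔲(N)` constant -/

section Adjoint

variable {d : ℕ} (L : ℕ) [NeZero L]
variable {n : Type} [Fintype n] [DecidableEq n] {κ : Type} [Fintype κ] [DecidableEq κ] (e : Matrix n n ℂ ≃L[ℝ] (κ → ℝ))

/-- ★ **THE KING INHABITANT OF THE CURVED KNIT AT A CONSTANT `𝔲(N)`-VALUED GAUGE FIELD IN THE ADJOINT REPRESENTATION.**  dag-n15-e's PART Ω-c explicit η-rate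
`hasMaj_idef_curvDressed_kingTorus_king_rate` at the generator datum `𝔄 = M_N(ℂ)` (Frobenius ∕ trace-form norm), `ι = κ`, `eB = e` trace-form-orthonormal (`he`),
`Zc μ = ad_{A_μ}` for a CONSTANT skew-Hermitian lattice gauge field `A_μ` with `‖A_μ‖ ≤ a₀`, `2a₀ ≤ 1` — the dressed pair of King's full `A = 0` propagator by the constant
NON-ABELIAN transporter `e^{η′ ad A_μ} = Ad(e^{η′A_μ})` on the fine torus (`e^{η ad A_μ}` on the coarse one); generator letter `r = 2a₀` by `‖ad_X‖ ≤ 2‖X‖`, skew coordinate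
matrices by file 3's `coordMat_adCLM_transpose_eq_neg_of_conjTranspose` — so of PART Ω-c's displayed data only the small-field bound, the skew-Hermitian values, `he` and the
halved Neumann smallness (in `r = 2a₀`) remain. [cite: Balaban1985BackgroundPropagators, (3.37) p.396, (3.50) p.400 (adjoint transporter: shape), Thm 3.1 (3.42) p.397 (η-rate shape), (3.63)–(3.65) pp.402–403 (mechanism); King1986, (2.13)–(2.17) p.653, Prop. 3.9 (3.73) p.665 (template)] -/
theorem uN_hasMaj_idef_curvDressed_kingTorus_king_rate (he : ∀ X Y : Matrix n n ℂ, traceForm X Y = e X ⬝ᵥ e Y) (hLodd : Odd L) (hL : 2 ≤ L) {a : ℝ} (ha : 0 < a)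
    {m0sq : ℝ} (hm0 : 0 ≤ m0sq) {γ : ℝ} (hγ0 : 0 < γ) (hγ1 : γ < 1) {α : ℝ} (hα0 : 0 < α) (hα1 : α < 1) :
    ∃ β δ m : ℝ, 0 < β ∧ 0 < δ ∧ 0 < m ∧ ∀ (K : ℕ), 1 ≤ K → ∀ (ex : ℕ) (M : Fin (d + 1) → ℕ) [∀ μ, NeZero (M μ)], (∀ μ, M μ = 2 * L ^ ex) →
      ∀ (msq : ℝ), 0 < msq → msq ≤ m0sq → ∀ (Msz : ℝ) (A : Fin (d + 1) → Matrix n n ℂ) (a₀ : ℝ), 0 ≤ a₀ → 2 * a₀ ≤ 1 → (∀ μ, ‖A μ‖ ≤ a₀) → (∀ μ, (A μ)ᴴ = -A μ) →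
      β * (expRowLetter κ (Fin (d + 1)) (basisConst e) (2 * a₀) 0 0 * (1 + Fintype.card (Fin (d + 1) ⊕ Fin (d + 1)))) * B4Sect5Proof.latticeConst (d + 1) (δ / 2) ≤ 1 / 2 →
      HasMaj (BlockNorm.ofBlocks (unitTorusGeoS L K M Msz) (liftBlk (blockOf (L ^ K) M) κ))
        (BlockNorm.ofBlocks (unitTorusGeoS L K M Msz) (blkPair (liftBlk (blockOf (L ^ K) M ∘ blockOf L (fine (L ^ K) M)) κ)))
        (idef (pull (liftMap (blockOf L (fine (L ^ K) M)) κ)) (pull (liftPair (liftMap (blockOf L (fine (L ^ K) M)) κ)))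
          (curvDressed ((L : ℝ) ^ (K + 1))⁻¹ (torStep (fine L (fine (L ^ K) M))) (expTrField e ((L : ℝ) ^ (K + 1))⁻¹ 0)
            (expTrField e ((L : ℝ) ^ (K + 1))⁻¹ (fun μ _ => adCLM ℝ (A μ))) (kingGT₁ L a msq K M κ))
          (curvDressed ((L : ℝ) * ((L : ℝ) ^ (K + 1))⁻¹) (torStep (fine (L ^ K) M))
            (expTrField e ((L : ℝ) * ((L : ℝ) ^ (K + 1))⁻¹) (blockMeanField L (fine (L ^ K) M) 0))
            (expTrField e ((L : ℝ) * ((L : ℝ) ^ (K + 1))⁻¹) (blockMeanField L (fine (L ^ K) M) (fun μ _ => adCLM ℝ (A μ)))) (kingGT L a msq K M κ)))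
        (fun y y' => 2 * B4Sect5Proof.latticeConst (d + 1) (δ / 2) *
            (m * (((L : ℝ) ^ K) ^ (-(γ / 2)) + ((L : ℝ) ^ K) ^ (-α)) *
                (1 + 2 * β * (expRowLetter κ (Fin (d + 1)) (basisConst e) (2 * a₀) 0 0 * (1 + Fintype.card (Fin (d + 1) ⊕ Fin (d + 1))))) +
              2 * β ^ 2 * (2 * basisConst e * Real.exp 1 * (2 * a₀) ^ 2 * ((L : ℝ) * ((L : ℝ) ^ (K + 1))⁻¹) *
                ((Fintype.card κ : ℝ) + (Fintype.card κ : ℝ) ^ 3 + 2 * (Fintype.card κ : ℝ) ^ 2 * (Fintype.card (Fin (d + 1)) : ℝ) * (basisConst e * Real.exp 1 * (2 * a₀))) *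
                (1 + Fintype.card (Fin (d + 1) ⊕ Fin (d + 1))))) *
          Real.exp (-(δ / 2 * tdistT M y y'))) := by
  obtain ⟨β, δ, m, hβ, hδ, hm, H⟩ := hasMaj_idef_curvDressed_kingTorus_king_rate (d := d) L hLodd hL ha hm0 hγ0 hγ1 hα0 hα1
  refine ⟨β, δ, m, hβ, hδ, hm, fun K hK ex M _ hM msq hmsq hcap Msz A a₀ ha0 ha1 hA hAs hq2 => ?_⟩
  -- the generator letter READ OFF the potential's letter through `‖ad_X‖ ≤ 2‖X‖`; skewness from file 3
  have hZc : ∀ μ, ‖adCLM ℝ (A μ)‖ ≤ 2 * a₀ := fun μ => (norm_adCLM_le ℝ _).trans (mul_le_mul_of_nonneg_left (hA μ) two_pos.le)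
  have hZcs : ∀ μ, (coordMat e (adCLM ℝ (A μ)))ᵀ = -coordMat e (adCLM ℝ (A μ)) := fun μ => coordMat_adCLM_transpose_eq_neg_of_conjTranspose e he (hAs μ)
  exact H K hK ex M hM msq hmsq hcap Msz κ (Matrix n n ℂ) e (fun μ => adCLM ℝ (A μ)) (2 * a₀) (by positivity) ha1 hZc hZcs hq2

/-- `L·(L^{K+1})⁻¹ = (L^K)⁻¹ ≤ (L^K)^{−α}` for `L ≥ 1`, `α ≤ 1`: the transporter-fit term of the η-rate is dominated by the rung's `θ_K`. [folklore] -/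
theorem mul_inv_pow_succ_le_rpow_neg {L : ℝ} (hL : 1 ≤ L) (K : ℕ) {α : ℝ} (hα1 : α ≤ 1) : L * (L ^ (K + 1))⁻¹ ≤ (L ^ K) ^ (-α) := by
  have hL0 : 0 < L := by linarith
  have hLK : 1 ≤ L ^ K := one_le_pow₀ hL
  have h1 : L * (L ^ (K + 1))⁻¹ = (L ^ K)⁻¹ := by
    rw [pow_succ, mul_inv, ← mul_assoc, mul_comm L, mul_assoc, mul_inv_cancel₀ hL0.ne', mul_one]
  rw [h1, ← Real.rpow_neg_one]
  exact Real.rpow_le_rpow_of_exponent_le hLK (by linarith)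

/-- THE SMALL-FIELD CHOICE MEETS THE NEUMANN SMALLNESS (pure arithmetic): `R ≤ aT`, `a ≤ 1∕D`, `D ≥ 4βTc + 1 > 0` ⟹ `βRc ≤ ½`. [folklore] -/
theorem smallness_of_smallField {β R c a T D : ℝ} (hβ : 0 ≤ β) (hc : 0 ≤ c) (hT : 0 ≤ T) (hR : R ≤ a * T) (hD : 0 < D)
    (hDge : 4 * β * T * c + 1 ≤ D) (haD : a ≤ 1 / D) : β * R * c ≤ 1 / 2 := by
  have h1 : β * R * c ≤ β * (a * T) * c := by gcongr
  have h2 : β * (a * T) * c ≤ β * (1 / D * T) * c := by gcongr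
  have h3 : β * (1 / D * T) * c = (β * T * c) / D := by ring
  have h4 : (β * T * c) / D ≤ 1 / 2 := by
    rw [div_le_iff₀ hD]
    nlinarith [mul_nonneg (mul_nonneg hβ hT) hc]
  linarith

/-- THE KNIT's η-RATE CONSTANT UNDER THE SMALL-FIELD CHOICE (pure arithmetic, the bracketing of PART Ω-c's `…_king_rate` kept): with the smallness `βRc ≤ ½`, the basis
constant `κ_e ≤ s`, the generator letter `a ≤ 1` and the fit spacing `η ≤ θ`,
`2c·(mθ(1 + 2βR) + 2β²·(2κ_e e a²η·(k + k³ + 2k²d_J·κ_e e a)·c_d)) ≤ (2cm + 2m + 4cβ²·(2se(k + k³ + 2k²d_J·se)c_d) + 1)·θ`. [folklore] -/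
theorem knitClosedConst_le {c m θ β R κe s a η k dJ cd : ℝ} (hc : 0 ≤ c) (hm : 0 ≤ m) (hθ : 0 ≤ θ) (hκe : 0 ≤ κe)
    (hκs : κe ≤ s) (ha0 : 0 ≤ a) (ha1 : a ≤ 1) (hη0 : 0 ≤ η) (hηθ : η ≤ θ) (hk : 0 ≤ k) (hdJ : 0 ≤ dJ) (hcd : 0 ≤ cd) (hq : β * R * c ≤ 1 / 2) :
    2 * c * (m * θ * (1 + 2 * β * R) + 2 * β ^ 2 * (2 * κe * Real.exp 1 * a ^ 2 * η * (k + k ^ 3 + 2 * k ^ 2 * dJ * (κe * Real.exp 1 * a)) * cd)) ≤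
      (2 * c * m + 2 * m + 4 * c * β ^ 2 * (2 * s * Real.exp 1 * (k + k ^ 3 + 2 * k ^ 2 * dJ * (s * Real.exp 1)) * cd) + 1) * θ := by
  have he : 0 ≤ Real.exp 1 := Real.exp_nonneg 1
  have hs : 0 ≤ s := hκe.trans hκs
  -- the defect term: `2c·mθ(1 + 2βR) ≤ (2cm + 2m)θ` by the smallness
  have hT1 : 2 * c * (m * θ * (1 + 2 * β * R)) ≤ (2 * c * m + 2 * m) * θ := by
    have h := mul_le_mul_of_nonneg_left hq (show 0 ≤ 4 * m * θ by positivity)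
    have e1 : 2 * c * (m * θ * (1 + 2 * β * R)) = 2 * c * m * θ + 4 * m * θ * (β * R * c) := by ring
    have e2 : (2 * c * m + 2 * m) * θ = 2 * c * m * θ + 4 * m * θ * (1 / 2) := by ring
    rw [e1, e2]
    linarith
  -- the fit term: `F ≤ F₀·θ`
  have hsq : a ^ 2 ≤ 1 := pow_le_one₀ ha0 ha1
  have hbr : k + k ^ 3 + 2 * k ^ 2 * dJ * (κe * Real.exp 1 * a) ≤ k + k ^ 3 + 2 * k ^ 2 * dJ * (s * Real.exp 1) := by
    have h1 : κe * Real.exp 1 * a ≤ s * Real.exp 1 * 1 := by gcongr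
    rw [mul_one] at h1
    gcongr
  have hbr0 : 0 ≤ k + k ^ 3 + 2 * k ^ 2 * dJ * (κe * Real.exp 1 * a) := by positivity
  have hT2 : 2 * κe * Real.exp 1 * a ^ 2 * η * (k + k ^ 3 + 2 * k ^ 2 * dJ * (κe * Real.exp 1 * a)) * cd ≤
      2 * s * Real.exp 1 * (k + k ^ 3 + 2 * k ^ 2 * dJ * (s * Real.exp 1)) * cd * θ :=
    calc 2 * κe * Real.exp 1 * a ^ 2 * η * (k + k ^ 3 + 2 * k ^ 2 * dJ * (κe * Real.exp 1 * a)) * cd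
        ≤ 2 * s * Real.exp 1 * 1 * θ * (k + k ^ 3 + 2 * k ^ 2 * dJ * (s * Real.exp 1)) * cd := by gcongr
      _ = 2 * s * Real.exp 1 * (k + k ^ 3 + 2 * k ^ 2 * dJ * (s * Real.exp 1)) * cd * θ := by ring
  have hF₀ : 0 ≤ 2 * s * Real.exp 1 * (k + k ^ 3 + 2 * k ^ 2 * dJ * (s * Real.exp 1)) * cd := by positivity
  have hT2' := mul_le_mul_of_nonneg_left hT2 (show 0 ≤ 2 * c * (2 * β ^ 2) by positivity)
  have e3 : 2 * c * (m * θ * (1 + 2 * β * R) + 2 * β ^ 2 * (2 * κe * Real.exp 1 * a ^ 2 * η * (k + k ^ 3 + 2 * k ^ 2 * dJ * (κe * Real.exp 1 * a)) * cd)) =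
      2 * c * (m * θ * (1 + 2 * β * R)) + 2 * c * (2 * β ^ 2) * (2 * κe * Real.exp 1 * a ^ 2 * η * (k + k ^ 3 + 2 * k ^ 2 * dJ * (κe * Real.exp 1 * a)) * cd) := by
    ring
  have e4 : (2 * c * m + 2 * m + 4 * c * β ^ 2 * (2 * s * Real.exp 1 * (k + k ^ 3 + 2 * k ^ 2 * dJ * (s * Real.exp 1)) * cd) + 1) * θ =
      (2 * c * m + 2 * m) * θ + 2 * c * (2 * β ^ 2) * (2 * s * Real.exp 1 * (k + k ^ 3 + 2 * k ^ 2 * dJ * (s * Real.exp 1)) * cd * θ) + θ := by ring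
  rw [e3, e4]
  linarith

/-- ★★ **THE CLOSED η-RATE STATEMENT FOR A CONSTANT NON-ABELIAN TRANSPORTER.**  For odd `L ≥ 3`, `a > 0`, `m₀² ≥ 0`, `0 < γ < 1`, `0 < α < 1` and trace-form-orthonormal
coordinates `e` of `M_N(ℂ)` there are `δ, C, a₀ > 0` such that for EVERY `K ≥ 1`, cube `M₀ ≡ 2L^e`, mass `0 < m² ≤ m₀²`, size datum `Msz` and EVERY constant skew-Hermitian
lattice gauge field `A` with `‖A_μ‖ ≤ a₀` the η-defect of the dressed pairs of King's full `A = 0` propagator — dressed by the adjoint transporters `e^{η′ ad A_μ}` (fine),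
`e^{η ad A_μ}` (coarse) — has the block majorant `C·((L^K)^{−γ∕2} + (L^K)^{−α})·e^{−(δ∕2)|y−y′|_T}`: §2 with the Neumann smallness DISCHARGED (§1's linear bound + file 6's
`κ_e ≤ √|κ|` make it a small-field condition, met by the choice of `a₀`) and the fit term absorbed (`(2a₀)²·L^{−K} ≤ (L^K)^{−α}`).  Displayed: NOTHING but the small-field
bound, the skew-Hermitian values and `he` (inhabited below). [cite: Balaban1985BackgroundPropagators, (3.37) p.396, (3.50) p.400 (adjoint transporter: shape), Thm 3.1 (3.42) p.397 (η-rate shape), (3.63)–(3.65) pp.402–403 (mechanism); King1986, (2.13)–(2.17) p.653, Prop. 3.9 (3.73) p.665 (template)] -/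
theorem uN_hasMaj_idef_curvDressed_kingTorus_king_closed (he : ∀ X Y : Matrix n n ℂ, traceForm X Y = e X ⬝ᵥ e Y) (hLodd : Odd L) (hL : 2 ≤ L) {a : ℝ} (ha : 0 < a)
    {m0sq : ℝ} (hm0 : 0 ≤ m0sq) {γ : ℝ} (hγ0 : 0 < γ) (hγ1 : γ < 1) {α : ℝ} (hα0 : 0 < α) (hα1 : α < 1) :
    ∃ δ C a₀ : ℝ, 0 < δ ∧ 0 < C ∧ 0 < a₀ ∧ ∀ (K : ℕ), 1 ≤ K → ∀ (ex : ℕ) (M : Fin (d + 1) → ℕ) [∀ μ, NeZero (M μ)], (∀ μ, M μ = 2 * L ^ ex) →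
      ∀ (msq : ℝ), 0 < msq → msq ≤ m0sq → ∀ (Msz : ℝ) (A : Fin (d + 1) → Matrix n n ℂ), (∀ μ, ‖A μ‖ ≤ a₀) → (∀ μ, (A μ)ᴴ = -A μ) →
      HasMaj (BlockNorm.ofBlocks (unitTorusGeoS L K M Msz) (liftBlk (blockOf (L ^ K) M) κ))
        (BlockNorm.ofBlocks (unitTorusGeoS L K M Msz) (blkPair (liftBlk (blockOf (L ^ K) M ∘ blockOf L (fine (L ^ K) M)) κ)))
        (idef (pull (liftMap (blockOf L (fine (L ^ K) M)) κ)) (pull (liftPair (liftMap (blockOf L (fine (L ^ K) M)) κ)))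
          (curvDressed ((L : ℝ) ^ (K + 1))⁻¹ (torStep (fine L (fine (L ^ K) M))) (expTrField e ((L : ℝ) ^ (K + 1))⁻¹ 0)
            (expTrField e ((L : ℝ) ^ (K + 1))⁻¹ (fun μ _ => adCLM ℝ (A μ))) (kingGT₁ L a msq K M κ))
          (curvDressed ((L : ℝ) * ((L : ℝ) ^ (K + 1))⁻¹) (torStep (fine (L ^ K) M))
            (expTrField e ((L : ℝ) * ((L : ℝ) ^ (K + 1))⁻¹) (blockMeanField L (fine (L ^ K) M) 0))
            (expTrField e ((L : ℝ) * ((L : ℝ) ^ (K + 1))⁻¹) (blockMeanField L (fine (L ^ K) M) (fun μ _ => adCLM ℝ (A μ)))) (kingGT L a msq K M κ)))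
        (fun y y' => C * (((L : ℝ) ^ K) ^ (-(γ / 2)) + ((L : ℝ) ^ K) ^ (-α)) * Real.exp (-(δ / 2 * tdistT M y y'))) := by
  obtain ⟨β, δ, m, hβ, hδ, hm, H⟩ := uN_hasMaj_idef_curvDressed_kingTorus_king_rate (d := d) L e he hLodd hL ha hm0 hγ0 hγ1 hα0 hα1
  -- the letters that do not depend on the level: `c_r`, `c_d = 1 + |J ⊕ J|`, `k = |κ|`, `d_J = |J|`, `s = √|κ| ≥ κ_e`, §1's slope `S` at `s`, `D = 4βSc_dc_r + 1`
  have hexp : 0 ≤ Real.exp 1 := Real.exp_nonneg 1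
  have hc : 0 ≤ B4Sect5Proof.latticeConst (d + 1) (δ / 2) := B4Sect5Proof.latticeConst_nonneg (d + 1) (half_pos hδ).le
  have hcd : (0 : ℝ) ≤ 1 + Fintype.card (Fin (d + 1) ⊕ Fin (d + 1)) := by positivity
  have hk : (0 : ℝ) ≤ Fintype.card κ := Nat.cast_nonneg _
  have hdJ : (0 : ℝ) ≤ Fintype.card (Fin (d + 1)) := Nat.cast_nonneg _
  have hs : 0 ≤ Real.sqrt (Fintype.card κ) := Real.sqrt_nonneg _
  have hκ0 : 0 ≤ basisConst e := basisConst_nonneg e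
  have hκs : basisConst e ≤ Real.sqrt (Fintype.card κ) := basisConst_le_sqrt_card_of_traceForm e he
  obtain ⟨S, hS_def⟩ : ∃ S : ℝ, S = Real.sqrt (Fintype.card κ) * Real.exp 1 * ((Fintype.card κ : ℝ) + (Fintype.card κ : ℝ) ^ 3) +
      (Fintype.card κ : ℝ) ^ 2 * (Fintype.card (Fin (d + 1)) : ℝ) * (Real.sqrt (Fintype.card κ) * Real.exp 1) ^ 2 := ⟨_, rfl⟩
  have hS : 0 ≤ S := by rw [hS_def]; positivity
  have hT : 0 ≤ S * (1 + Fintype.card (Fin (d + 1) ⊕ Fin (d + 1))) := mul_nonneg hS hcd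
  obtain ⟨D, hD_def⟩ : ∃ D : ℝ, D = 4 * β * (S * (1 + Fintype.card (Fin (d + 1) ⊕ Fin (d + 1)))) * B4Sect5Proof.latticeConst (d + 1) (δ / 2) + 1 := ⟨_, rfl⟩
  have hD : 0 < D := by rw [hD_def]; positivity
  have hF₀ : 0 ≤ 2 * Real.sqrt (Fintype.card κ) * Real.exp 1 *
      ((Fintype.card κ : ℝ) + (Fintype.card κ : ℝ) ^ 3 + 2 * (Fintype.card κ : ℝ) ^ 2 * (Fintype.card (Fin (d + 1)) : ℝ) * (Real.sqrt (Fintype.card κ) * Real.exp 1)) *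
      (1 + Fintype.card (Fin (d + 1) ⊕ Fin (d + 1))) := by positivity
  refine ⟨δ, 2 * B4Sect5Proof.latticeConst (d + 1) (δ / 2) * m + 2 * m + 4 * B4Sect5Proof.latticeConst (d + 1) (δ / 2) * β ^ 2 *
      (2 * Real.sqrt (Fintype.card κ) * Real.exp 1 *
        ((Fintype.card κ : ℝ) + (Fintype.card κ : ℝ) ^ 3 + 2 * (Fintype.card κ : ℝ) ^ 2 * (Fintype.card (Fin (d + 1)) : ℝ) * (Real.sqrt (Fintype.card κ) * Real.exp 1)) *
        (1 + Fintype.card (Fin (d + 1) ⊕ Fin (d + 1)))) + 1,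
    min (1 / 2) (1 / (2 * D)), hδ, by positivity, lt_min (by norm_num) (by positivity), fun K hK ex M _ hM msq hmsq hcap Msz A hA hAs => ?_⟩
  -- the small-field bound `a₀ = min (1∕2) (1∕(2D))`: `2a₀ ≤ 1` and `2a₀ ≤ 1∕D`
  have ha0 : 0 ≤ min (1 / 2 : ℝ) (1 / (2 * D)) := (lt_min (by norm_num : (0 : ℝ) < 1 / 2) (by positivity : (0 : ℝ) < 1 / (2 * D))).le
  have ha1 : 2 * min (1 / 2 : ℝ) (1 / (2 * D)) ≤ 1 := by have h := min_le_left (1 / 2 : ℝ) (1 / (2 * D)); linarith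
  have haD : 2 * min (1 / 2 : ℝ) (1 / (2 * D)) ≤ 1 / D := by
    have h := min_le_right (1 / 2 : ℝ) (1 / (2 * D))
    have e1 : 2 * (1 / (2 * D)) = 1 / D := by field_simp
    linarith
  have hr0 : 0 ≤ 2 * min (1 / 2 : ℝ) (1 / (2 * D)) := by positivity
  -- the row letter `R_V·c_d ≤ (2a₀)·S·c_d` (§1 + `κ_e ≤ √|κ|`)
  have hR : expRowLetter κ (Fin (d + 1)) (basisConst e) (2 * min (1 / 2 : ℝ) (1 / (2 * D))) 0 0 * (1 + Fintype.card (Fin (d + 1) ⊕ Fin (d + 1))) ≤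
      2 * min (1 / 2 : ℝ) (1 / (2 * D)) * (S * (1 + Fintype.card (Fin (d + 1) ⊕ Fin (d + 1)))) := by
    rw [← mul_assoc]
    refine mul_le_mul_of_nonneg_right ((expRowLetter_flat_le κ (Fin (d + 1)) hκ0 hr0 ha1).trans ?_) hcd
    rw [hS_def]
    exact mul_le_mul_of_nonneg_left (expRowLetter_flat_slope_mono κ (Fin (d + 1)) hκ0 hκs) hr0
  -- the Neumann smallness HOLDS
  have hq2 : β * (expRowLetter κ (Fin (d + 1)) (basisConst e) (2 * min (1 / 2 : ℝ) (1 / (2 * D))) 0 0 * (1 + Fintype.card (Fin (d + 1) ⊕ Fin (d + 1)))) *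
      B4Sect5Proof.latticeConst (d + 1) (δ / 2) ≤ 1 / 2 :=
    smallness_of_smallField hβ.le hc hT hR hD (le_of_eq hD_def.symm) haD
  have key := H K hK ex M hM msq hmsq hcap Msz A (min (1 / 2) (1 / (2 * D))) ha0 ha1 hA hAs hq2
  refine key.mono fun y y' => mul_le_mul_of_nonneg_right ?_ (Real.exp_nonneg _)
  -- letters of the level: `θ_K ≥ 0`, `L·(L^{K+1})⁻¹ ≤ (L^K)^{−α} ≤ θ_K`
  have hL1 : (1 : ℝ) ≤ (L : ℝ) := by exact_mod_cast (show 1 ≤ L by omega)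
  have hL0 : (0 : ℝ) < (L : ℝ) := by positivity
  have hθ : 0 ≤ ((L : ℝ) ^ K) ^ (-(γ / 2)) + ((L : ℝ) ^ K) ^ (-α) :=
    add_nonneg (Real.rpow_nonneg (pow_nonneg hL0.le _) _) (Real.rpow_nonneg (pow_nonneg hL0.le _) _)
  have hηθ : (L : ℝ) * ((L : ℝ) ^ (K + 1))⁻¹ ≤ ((L : ℝ) ^ K) ^ (-(γ / 2)) + ((L : ℝ) ^ K) ^ (-α) :=
    (mul_inv_pow_succ_le_rpow_neg hL1 K hα1.le).trans (le_add_of_nonneg_left (Real.rpow_nonneg (pow_nonneg hL0.le _) _))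
  have hη0 : 0 ≤ (L : ℝ) * ((L : ℝ) ^ (K + 1))⁻¹ := by positivity
  exact knitClosedConst_le hc hm.le hθ hκ0 hκs hr0 ha1 hη0 hηθ hk hdJ hcd hq2

/-- THE `𝔰𝔲(N)` EDITION (the programme's structure group): §3's closed statement for constant `𝔰𝔲(N)`-valued gauge fields `A_μ ∈ suAlgebra N` (skew-Hermitian and traceless —
only skew-Hermitian is used). [cite: Balaban1985BackgroundPropagators, (3.37) p.396, (3.50) p.400 (shape)] -/
theorem suN_hasMaj_idef_curvDressed_kingTorus_king_closed {N : ℕ} {κ : Type} [Fintype κ] [DecidableEq κ] (e : Matrix (Fin N) (Fin N) ℂ ≃L[ℝ] (κ → ℝ))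
    (he : ∀ X Y : Matrix (Fin N) (Fin N) ℂ, traceForm X Y = e X ⬝ᵥ e Y) (hLodd : Odd L) (hL : 2 ≤ L) {a : ℝ} (ha : 0 < a)
    {m0sq : ℝ} (hm0 : 0 ≤ m0sq) {γ : ℝ} (hγ0 : 0 < γ) (hγ1 : γ < 1) {α : ℝ} (hα0 : 0 < α) (hα1 : α < 1) :
    ∃ δ C a₀ : ℝ, 0 < δ ∧ 0 < C ∧ 0 < a₀ ∧ ∀ (K : ℕ), 1 ≤ K → ∀ (ex : ℕ) (M : Fin (d + 1) → ℕ) [∀ μ, NeZero (M μ)], (∀ μ, M μ = 2 * L ^ ex) →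
      ∀ (msq : ℝ), 0 < msq → msq ≤ m0sq → ∀ (Msz : ℝ) (A : Fin (d + 1) → Matrix (Fin N) (Fin N) ℂ), (∀ μ, ‖A μ‖ ≤ a₀) → (∀ μ, A μ ∈ suAlgebra N) →
      HasMaj (BlockNorm.ofBlocks (unitTorusGeoS L K M Msz) (liftBlk (blockOf (L ^ K) M) κ))
        (BlockNorm.ofBlocks (unitTorusGeoS L K M Msz) (blkPair (liftBlk (blockOf (L ^ K) M ∘ blockOf L (fine (L ^ K) M)) κ)))
        (idef (pull (liftMap (blockOf L (fine (L ^ K) M)) κ)) (pull (liftPair (liftMap (blockOf L (fine (L ^ K) M)) κ)))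
          (curvDressed ((L : ℝ) ^ (K + 1))⁻¹ (torStep (fine L (fine (L ^ K) M))) (expTrField e ((L : ℝ) ^ (K + 1))⁻¹ 0)
            (expTrField e ((L : ℝ) ^ (K + 1))⁻¹ (fun μ _ => adCLM ℝ (A μ))) (kingGT₁ L a msq K M κ))
          (curvDressed ((L : ℝ) * ((L : ℝ) ^ (K + 1))⁻¹) (torStep (fine (L ^ K) M))
            (expTrField e ((L : ℝ) * ((L : ℝ) ^ (K + 1))⁻¹) (blockMeanField L (fine (L ^ K) M) 0))
            (expTrField e ((L : ℝ) * ((L : ℝ) ^ (K + 1))⁻¹) (blockMeanField L (fine (L ^ K) M) (fun μ _ => adCLM ℝ (A μ)))) (kingGT L a msq K M κ)))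
        (fun y y' => C * (((L : ℝ) ^ K) ^ (-(γ / 2)) + ((L : ℝ) ^ K) ^ (-α)) * Real.exp (-(δ / 2 * tdistT M y y'))) := by
  obtain ⟨δ, C, a₀, hδ, hC, ha₀, H⟩ := uN_hasMaj_idef_curvDressed_kingTorus_king_closed (d := d) L e he hLodd hL ha hm0 hγ0 hγ1 hα0 hα1
  exact ⟨δ, C, a₀, hδ, hC, ha₀, fun K hK ex M _ hM msq hmsq hcap Msz A hA hAsu =>
    H K hK ex M hM msq hmsq hcap Msz A hA fun μ => ((mem_suAlgebra_iff (A μ)).mp (hAsu μ)).1⟩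

end Adjoint

/-! ## §4 `he` inhabited in the same file: the fully closed statement in the explicit coordinates `(Re X_{ij}, Im X_{ij})` -/

section Coords

variable {d : ℕ} (L : ℕ) [NeZero L] {n : Type} [Fintype n] [DecidableEq n]

/-- ★ **FOR EVERY `N`: A FULLY CLOSED NON-ABELIAN η-RATE STATEMENT.**  §3 at file 3's EXPLICIT trace-form-orthonormal coordinates `X ↦ (Re X_{ij}, Im X_{ij})`
(`traceForm_exists_coords`, `κ = n × n × Fin 2`): there are coordinates `e` and `δ, C, a₀ > 0` such that for every level `K ≥ 1`, cube, mass, size datum and every constant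
skew-Hermitian gauge field with `‖A_μ‖ ≤ a₀` the two-grid defect of King's propagator dressed by `Ad(e^{η′A_μ})` is `≤ C·((L^K)^{−γ∕2} + (L^K)^{−α})·e^{−(δ∕2)|y−y′|_T}` — the
knit's whole hypothesis list inhabited by a NON-ABELIAN datum with nothing displayed but the small-field bound (A6: antecedent inhabited here). [cite: Balaban1985BackgroundPropagators, (3.37) p.396, (3.50) p.400 (shape), Thm 3.1 (3.42) p.397 (η-rate shape); King1986, Prop. 3.9 (3.73) p.665 (template)] -/
theorem uN_exists_coords_hasMaj_idef_curvDressed_kingTorus_king_closed (hLodd : Odd L) (hL : 2 ≤ L) {a : ℝ} (ha : 0 < a)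
    {m0sq : ℝ} (hm0 : 0 ≤ m0sq) {γ : ℝ} (hγ0 : 0 < γ) (hγ1 : γ < 1) {α : ℝ} (hα0 : 0 < α) (hα1 : α < 1) :
    ∃ (e : Matrix n n ℂ ≃L[ℝ] (n × n × Fin 2 → ℝ)) (δ C a₀ : ℝ), (∀ X Y : Matrix n n ℂ, traceForm X Y = e X ⬝ᵥ e Y) ∧ 0 < δ ∧ 0 < C ∧ 0 < a₀ ∧
      ∀ (K : ℕ), 1 ≤ K → ∀ (ex : ℕ) (M : Fin (d + 1) → ℕ) [∀ μ, NeZero (M μ)], (∀ μ, M μ = 2 * L ^ ex) →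
      ∀ (msq : ℝ), 0 < msq → msq ≤ m0sq → ∀ (Msz : ℝ) (A : Fin (d + 1) → Matrix n n ℂ), (∀ μ, ‖A μ‖ ≤ a₀) → (∀ μ, (A μ)ᴴ = -A μ) →
      HasMaj (BlockNorm.ofBlocks (unitTorusGeoS L K M Msz) (liftBlk (blockOf (L ^ K) M) (n × n × Fin 2)))
        (BlockNorm.ofBlocks (unitTorusGeoS L K M Msz) (blkPair (liftBlk (blockOf (L ^ K) M ∘ blockOf L (fine (L ^ K) M)) (n × n × Fin 2))))
        (idef (pull (liftMap (blockOf L (fine (L ^ K) M)) (n × n × Fin 2))) (pull (liftPair (liftMap (blockOf L (fine (L ^ K) M)) (n × n × Fin 2))))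
          (curvDressed ((L : ℝ) ^ (K + 1))⁻¹ (torStep (fine L (fine (L ^ K) M))) (expTrField e ((L : ℝ) ^ (K + 1))⁻¹ 0)
            (expTrField e ((L : ℝ) ^ (K + 1))⁻¹ (fun μ _ => adCLM ℝ (A μ))) (kingGT₁ L a msq K M (n × n × Fin 2)))
          (curvDressed ((L : ℝ) * ((L : ℝ) ^ (K + 1))⁻¹) (torStep (fine (L ^ K) M))
            (expTrField e ((L : ℝ) * ((L : ℝ) ^ (K + 1))⁻¹) (blockMeanField L (fine (L ^ K) M) 0))
            (expTrField e ((L : ℝ) * ((L : ℝ) ^ (K + 1))⁻¹) (blockMeanField L (fine (L ^ K) M) (fun μ _ => adCLM ℝ (A μ)))) (kingGT L a msq K M (n × n × Fin 2))))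
        (fun y y' => C * (((L : ℝ) ^ K) ^ (-(γ / 2)) + ((L : ℝ) ^ K) ^ (-α)) * Real.exp (-(δ / 2 * tdistT M y y'))) := by
  obtain ⟨e, he⟩ := traceForm_exists_coords (n := n)
  obtain ⟨δ, C, a₀, hδ, hC, ha₀, H⟩ := uN_hasMaj_idef_curvDressed_kingTorus_king_closed (d := d) L e he hLodd hL ha hm0 hγ0 hγ1 hα0 hα1
  exact ⟨e, δ, C, a₀, he, hδ, hC, ha₀, H⟩

end Coords

end Summit.QuantumFields.YangMills.BalabanUVNodes.N15.CurvedSpecies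

end
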